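import Summits.CriticalPhenomena.PercolationContinuityZ3.Theorems.Transplant.FKDoubleFanWedge
import HarnessLib

/-!
# Double fans `K₂ ∨ P_{m+1}`, far cross-apex pairs: the exact threshold `q_T` (`q³ + 3q² + 8q − 4 = 0`, `q_T = 0.42301…`) of the TERMWISE route
# for GENUINE inputs

Helper file (`--supports stmt-CriticalPhenomena-4575`), FK sub-lane `prim-bschramm-fk-3` (gen 31; the family is gen 27's, memo `FAR-CROSS-II.md` §5); builds on
p205010 (kernel theorem, internal audit signed; external expert review pending).  Pure real algebra, no sorries; standard axioms.  Memo
`bschramm/prim-bschramm-fk-3/FAR-CROSS-VI.md` §4.  Companion of `…DoubleFanValidUThreshold` (threshold `q = 1/2` of the `Valid ∧ U` relaxation).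

The termwise route (`…DoubleFanWedge`, `…WedgeWord`; criterion files `…SeedCone`, `…OrbitCone`) needs a set of bivectors mapped into itself by the three
polarisations `T_D, T_a, T_b`, containing every input `u ∧ P_a u` (`u ∈ InKE q`) and pairing non-negatively with every target `s ∧ P_b s` (`s ∈ InKE q`).
Take the simplest genuine input `u = δ₀` and the axis-letter targets `s_w = AB_w ∗ δ₀` (both in `InKE q`: **`inKE_axisState`**).  Then, EXACTLY
(**`pairH_TaTDTbTD_delta0_axis`**),
  `⟪T_a T_D T_b T_D (δ₀ ∧ P_a δ₀), s_w ∧ P_b s_w⟫ = q(1−q)·[q² − (1−q)(2−q)·w + 2(1−q)·w²]`,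
a quadratic in `w` minimised at `w* = (2−q)/4 ∈ [0,1]` with minimum `q(1−q)·(8q² − (1−q)(2−q)²)/8` (**`pairH_TaTDTbTD_delta0_axis_min`**), and
`8q² − (1−q)(2−q)² = q³ + 3q² + 8q − 4`.  Hence
* **`termwise_family_nonneg`**: if `q³ + 3q² + 8q − 4 ≥ 0` (`0 ≤ q ≤ 1`) the family is harmless (`≥ 0` for every `w`);
* **`termwise_family_neg`**: if `q³ + 3q² + 8q − 4 < 0` (`0 < q < 1`), i.e. `q < q_T = 0.42301…`, the pairing at `w*` is NEGATIVE, so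
  (**`no_termwise_stable_set_below_qT`**) NO set of bivectors stable under `T_D, T_a, T_b` contains the genuine input `δ₀ ∧ P_a δ₀` and pairs
  non-negatively with the genuine targets `s_w ∧ P_b s_w`: every `IsTCone / IsTStable`-type criterion is vacuous below `q_T` (e.g. at `q = 2/5`:
  **`no_termwise_stable_set_two_fifths`**).  Numerically (memo II §5, VI §4) nothing negative occurs for `q ≥ 0.44`; CONJECTURE T asserts the route works on `[1/2, 1]`.
[cite: Grimmett2006, §3.9 eq. (3.94) (pp. 63–64)] [folklore]
-/

noncomputable section

namespace Summit.CriticalPhenomena.PercolationContinuityZ3.Theorems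

namespace FK

namespace ThreeApex

/-- The axis-letter state `s_w = AB_w ∗ δ₀` is a genuine element of `InKE q` (`w ∈ [0,1]`), and so is `δ₀`. [folklore] -/
theorem inKE_axisState (q : ℝ) {w : ℝ} (hw0 : 0 ≤ w) (hw1 : w ≤ 1) : InKE q delta0 ∧ InKE q (conv (edgeAB w) delta0) :=
  ⟨InKE.base, InKE.step (IsLetter.ab hw0 hw1) InKE.base⟩

/-- **The exact value of gen 27's extremal termwise coefficient:**
`⟪T_a T_D T_b T_D (δ₀ ∧ P_a δ₀), s_w ∧ P_b s_w⟫ = q(1−q)[q² − (1−q)(2−q)w + 2(1−q)w²]`. [folklore] -/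
theorem pairH_TaTDTbTD_delta0_axis (q w : ℝ) :
    pairH q (opTa (opTD q (opTb (opTD q (wedgeH (conv (edgeAC 0) delta0) (conv (edgeAC 1) delta0))))))
        (wedgeH (conv (edgeBC 0) (conv (edgeAB w) delta0)) (conv (edgeBC 1) (conv (edgeAB w) delta0))) =
      q * (1 - q) * (q ^ 2 - (1 - q) * (2 - q) * w + 2 * (1 - q) * w ^ 2) := by
  simp only [pairH, opTa, opTb, opTD, wedgeH, conv, edgeAC, edgeBC, edgeAB, delta0, hx, hy, hz, V5.total]
  ring

/-- Completing the square in `w`: `q² − (1−q)(2−q)w + 2(1−q)w² = 2(1−q)(w − (2−q)/4)² + (8q² − (1−q)(2−q)²)/8`, and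
`8q² − (1−q)(2−q)² = q³ + 3q² + 8q − 4`. [folklore] -/
theorem termwise_family_sq (q w : ℝ) :
    q ^ 2 - (1 - q) * (2 - q) * w + 2 * (1 - q) * w ^ 2 = 2 * (1 - q) * (w - (2 - q) / 4) ^ 2 + (q ^ 3 + 3 * q ^ 2 + 8 * q - 4) / 8 := by
  ring

/-- The minimum over `w` (at `w* = (2−q)/4`): `⟪…⟫ = q(1−q)(q³ + 3q² + 8q − 4)/8`. [folklore] -/
theorem pairH_TaTDTbTD_delta0_axis_min (q : ℝ) :
    pairH q (opTa (opTD q (opTb (opTD q (wedgeH (conv (edgeAC 0) delta0) (conv (edgeAC 1) delta0))))))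
        (wedgeH (conv (edgeBC 0) (conv (edgeAB ((2 - q) / 4)) delta0)) (conv (edgeBC 1) (conv (edgeAB ((2 - q) / 4)) delta0))) =
      q * (1 - q) * (q ^ 3 + 3 * q ^ 2 + 8 * q - 4) / 8 := by
  rw [pairH_TaTDTbTD_delta0_axis, termwise_family_sq]; ring

/-- **Above `q_T` the family is harmless:** if `q³ + 3q² + 8q − 4 ≥ 0` and `0 ≤ q ≤ 1`, the pairing is `≥ 0` for every `w`. [folklore] -/
theorem termwise_family_nonneg {q : ℝ} (hq0 : 0 ≤ q) (hq1 : q ≤ 1) (h : 0 ≤ q ^ 3 + 3 * q ^ 2 + 8 * q - 4) (w : ℝ) :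
    0 ≤ pairH q (opTa (opTD q (opTb (opTD q (wedgeH (conv (edgeAC 0) delta0) (conv (edgeAC 1) delta0))))))
        (wedgeH (conv (edgeBC 0) (conv (edgeAB w) delta0)) (conv (edgeBC 1) (conv (edgeAB w) delta0))) := by
  rw [pairH_TaTDTbTD_delta0_axis, termwise_family_sq]
  have h1 : 0 ≤ 1 - q := sub_nonneg.2 hq1
  have h2 : 0 ≤ 2 * (1 - q) * (w - (2 - q) / 4) ^ 2 + (q ^ 3 + 3 * q ^ 2 + 8 * q - 4) / 8 := by positivity
  have h3 : 0 ≤ q * (1 - q) := mul_nonneg hq0 h1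
  exact mul_nonneg h3 h2

/-- **Below `q_T` the family is negative:** if `q³ + 3q² + 8q − 4 < 0` and `0 < q < 1`, then `w* = (2−q)/4 ∈ [0,1]` and the pairing at `w*` is `< 0`.
[folklore] -/
theorem termwise_family_neg {q : ℝ} (hq0 : 0 < q) (hq1 : q < 1) (h : q ^ 3 + 3 * q ^ 2 + 8 * q - 4 < 0) :
    0 ≤ (2 - q) / 4 ∧ (2 - q) / 4 ≤ 1 ∧
      pairH q (opTa (opTD q (opTb (opTD q (wedgeH (conv (edgeAC 0) delta0) (conv (edgeAC 1) delta0))))))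
        (wedgeH (conv (edgeBC 0) (conv (edgeAB ((2 - q) / 4)) delta0)) (conv (edgeBC 1) (conv (edgeAB ((2 - q) / 4)) delta0))) < 0 := by
  refine ⟨by linarith, by linarith, ?_⟩
  rw [pairH_TaTDTbTD_delta0_axis_min]
  have h1 : 0 < q * (1 - q) := mul_pos hq0 (by linarith)
  have h2 : q * (1 - q) * (q ^ 3 + 3 * q ^ 2 + 8 * q - 4) < 0 := mul_neg_of_pos_of_neg h1 h
  linarith

/-- **No termwise-stable set below `q_T`.**  If `q³ + 3q² + 8q − 4 < 0` (`0 < q < 1`), no set of bivectors mapped into itself by `T_D`, `T_a` and `T_b`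
contains the genuine input `δ₀ ∧ P_a δ₀` and pairs non-negatively with the targets of all genuine suffixes `s ∈ InKE q` (no convexity, closedness or
polyhedrality assumed): the hypotheses of every `IsTCone / IsTStable`-type criterion are unsatisfiable there. [folklore] -/
theorem no_termwise_stable_set_below_qT {q : ℝ} (hq0 : 0 < q) (hq1 : q < 1) (h : q ^ 3 + 3 * q ^ 2 + 8 * q - 4 < 0) :
    ¬ ∃ K : Set Biv, (∀ β, β ∈ K → opTD q β ∈ K) ∧ (∀ β, β ∈ K → opTa β ∈ K) ∧ (∀ β, β ∈ K → opTb β ∈ K) ∧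
      wedgeH (conv (edgeAC 0) delta0) (conv (edgeAC 1) delta0) ∈ K ∧
        (∀ β, β ∈ K → ∀ s, InKE q s → 0 ≤ pairH q β (wedgeH (conv (edgeBC 0) s) (conv (edgeBC 1) s))) := by
  rintro ⟨K, hD, hA, hB, hin, hpos⟩
  obtain ⟨hw0, hw1, hneg⟩ := termwise_family_neg hq0 hq1 h
  have hs : InKE q (conv (edgeAB ((2 - q) / 4)) delta0) := (inKE_axisState q hw0 hw1).2
  have := hpos _ (hA _ (hD _ (hB _ (hD _ hin)))) _ hs
  linarith

/-- **The instance `q = 2/5 < q_T`:** `(2/5)³ + 3(2/5)² + 8(2/5) − 4 = −32/125 < 0`, so no termwise-stable set exists at `q = 2/5`. [folklore] -/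
theorem no_termwise_stable_set_two_fifths :
    ¬ ∃ K : Set Biv, (∀ β, β ∈ K → opTD (2 / 5) β ∈ K) ∧ (∀ β, β ∈ K → opTa β ∈ K) ∧ (∀ β, β ∈ K → opTb β ∈ K) ∧
      wedgeH (conv (edgeAC 0) delta0) (conv (edgeAC 1) delta0) ∈ K ∧
        (∀ β, β ∈ K → ∀ s, InKE (2 / 5) s → 0 ≤ pairH (2 / 5) β (wedgeH (conv (edgeBC 0) s) (conv (edgeBC 1) s))) :=
  no_termwise_stable_set_below_qT (by norm_num) (by norm_num) (by norm_num)

/-- **At `q = 1/2` the family is harmless** (`1/8 + 3/4 + 4 − 4 = 7/8 ≥ 0`), consistent with CONJECTURE T on `[1/2, 1]`. [folklore] -/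
theorem termwise_family_nonneg_half (w : ℝ) :
    0 ≤ pairH (1 / 2) (opTa (opTD (1 / 2) (opTb (opTD (1 / 2) (wedgeH (conv (edgeAC 0) delta0) (conv (edgeAC 1) delta0))))))
        (wedgeH (conv (edgeBC 0) (conv (edgeAB w) delta0)) (conv (edgeBC 1) (conv (edgeAB w) delta0))) :=
  termwise_family_nonneg (by norm_num) (by norm_num) (by norm_num) w

end ThreeApex

end FK

end Summit.CriticalPhenomena.PercolationContinuityZ3.Theorems
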